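import Mathlib
import Literature.Probability.LatticeModels.ProdBernoulliIndependence
import Literature.Probability.Percolation.ConditionalPositiveAssociation
import Literature.Probability.Percolation.ConditionalPositiveAssociationProofs
import Literature.Probability.Percolation.TwoClusterConditionalAssociation
import Literature.Probability.Percolation.PercolationProofs
import Literature.Probability.Percolation.ClusterBoundary
import HarnessLib

/-!
# Crux `PercNearOneGluing.NearOneGluing` (stmt-CriticalPhenomena-4574), line `bhk-dyadic-thinning` — sub-goal `multiCopyFootprint`

Helper file for the crux (lead prover-line-stmt-CriticalPhenomena-4574-0, wave 2): tooling /
partial result for the residual `stub_doomWindow`.  Proves exactly the registered sub-goal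
signature; lands with `--supports stmt-CriticalPhenomena-4574`.

## Content: the multi-copy footprint lemma

Notation: `μ = prodBernoulli w` on `Set (Sym2 (Fin n))`, `B = {o ↮ b}`, `u = μ(B)`,
`π(K) = μ(C(b) = K)` for `K ∌ o` (so `∑_{K ∌ o} π(K) = u`), `D(X) = μ(o ↮ X)`,
`N(ω) = #{a ∈ A : o ↔ a}` (the footprint).  HYPOTHESIS (fresh-pocket averaging for the
instance): `∀ X, ∑_{K ∌ o} π(K) D(X ∖ K) ≤ μ(o ↮ X, o ↮ b)`.  CONCLUSION: for `0 < δ`,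
`0 < θ < 1`, `D(A) ≤ δ`, `μ(a ↮ b) ≤ δ` (`a ∈ A`):
`(1 - θ) u^j μ{o ↮ b, N δ^j < θ u^j} ≤ δ`.

Proof (pure finite sums).  Define the weight recursion `V_0(Y)(ω) = 1{∃ a ∈ Y, o ↔ a}`,
`V_{i+1}(Y)(ω) = ∑_{K ∌ o} π(K) V_i(Y ∖ K)(ω)`.  Then
* `E[1_B V_i(Y)] ≥ u^{i+1} - D(Y)` (induction; the step is the hypothesis and `∑ π = u`);
* `V_i(Y) ≤ u^i` pointwise;
* `V_i(Y)(ω) ≤ ∑_{a ∈ Y, o ↔ a} s_a^i` with `s_a = ∑_{K ∌ o, K ∌ a} π(K) ≤ μ(a ↮ b) ≤ δ`,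
  whence `V_j(A) ≤ N δ^j`;
* splitting `B` according to `{N δ^j < θ u^j}`:
  `u^{j+1} - δ ≤ E[1_B V_j(A)] ≤ u^{j+1} - (1 - θ) u^j μ{o ↮ b, N δ^j < θ u^j}`.
-/

namespace Summit.CriticalPhenomena.PercolationContinuityZ3.Theorems

open scoped BigOperators Classical
open MeasureTheory Set
open Literature.Probability.LatticeModels (prodBernoulli)
open Literature.Probability.Percolation (openConn openConnIn openCluster
  measurableSet_openConn_holds)

namespace MultiCopyFootprint

section Abstract

variable {ι Ω : Type*} [DecidableEq ι]

/-- Pointwise bound `V_i(Y) ≤ u^i` for the weight recursion (`∑_K π K = u`, `π ≥ 0`).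
[folklore] -/
theorem weightRec_le_pow (𝒦 : Finset (Finset ι)) (π : Finset ι → ℝ)
    (hπ : ∀ K ∈ 𝒦, 0 ≤ π K) (conn : ι → Set Ω) (V : ℕ → Finset ι → Ω → ℝ)
    (hV0 : ∀ Y ω, V 0 Y ω = (⋃ a ∈ Y, conn a).indicator 1 ω)
    (hVs : ∀ i Y ω, V (i + 1) Y ω = ∑ K ∈ 𝒦, π K * V i (Y \ K) ω) (u : ℝ)
    (hu : ∑ K ∈ 𝒦, π K = u) :
    ∀ (i : ℕ) (Y : Finset ι) (ω : Ω), V i Y ω ≤ u ^ i := by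
  intro i
  induction i with
  | zero =>
    intro Y ω
    rw [hV0, pow_zero]
    by_cases h : ω ∈ ⋃ a ∈ Y, conn a
    · rw [Set.indicator_of_mem h, Pi.one_apply]
    · rw [Set.indicator_of_notMem h]
      exact zero_le_one
  | succ i ih =>
    intro Y ω
    rw [hVs]
    calc ∑ K ∈ 𝒦, π K * V i (Y \ K) ω ≤ ∑ K ∈ 𝒦, π K * u ^ i :=
          Finset.sum_le_sum fun K hK => mul_le_mul_of_nonneg_left (ih _ _) (hπ K hK)
      _ = u ^ (i + 1) := by rw [← Finset.sum_mul, hu, pow_succ']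

/-- Pointwise footprint bound `V_i(Y)(ω) ≤ ∑_{a ∈ Y, ω ∈ conn a} s_a^i`,
`s_a = ∑_{K ∈ 𝒦, a ∉ K} π K` (transversal counting). [folklore] -/
theorem weightRec_le_footprint (𝒦 : Finset (Finset ι)) (π : Finset ι → ℝ)
    (hπ : ∀ K ∈ 𝒦, 0 ≤ π K) (conn : ι → Set Ω) (V : ℕ → Finset ι → Ω → ℝ)
    (hV0 : ∀ Y ω, V 0 Y ω = (⋃ a ∈ Y, conn a).indicator 1 ω)
    (hVs : ∀ i Y ω, V (i + 1) Y ω = ∑ K ∈ 𝒦, π K * V i (Y \ K) ω) :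
    ∀ (i : ℕ) (Y : Finset ι) (ω : Ω), V i Y ω ≤
      ∑ a ∈ Y.filter (fun a => ω ∈ conn a),
        (∑ K ∈ 𝒦.filter (fun K => a ∉ K), π K) ^ i := by
  intro i
  induction i with
  | zero =>
    intro Y ω
    rw [hV0]
    simp only [pow_zero, Finset.sum_const, nsmul_eq_mul, mul_one]
    by_cases h : ω ∈ ⋃ a ∈ Y, conn a
    · rw [Set.indicator_of_mem h, Pi.one_apply]
      obtain ⟨a, haY, ha⟩ := Set.mem_iUnion₂.1 h
      have : a ∈ Y.filter (fun a => ω ∈ conn a) := Finset.mem_filter.2 ⟨haY, ha⟩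
      exact_mod_cast Finset.card_pos.2 ⟨a, this⟩
    · rw [Set.indicator_of_notMem h]
      positivity
  | succ i ih =>
    intro Y ω
    rw [hVs]
    calc ∑ K ∈ 𝒦, π K * V i (Y \ K) ω
        ≤ ∑ K ∈ 𝒦, π K * ∑ a ∈ (Y \ K).filter (fun a => ω ∈ conn a),
            (∑ K ∈ 𝒦.filter (fun K => a ∉ K), π K) ^ i :=
          Finset.sum_le_sum fun K hK => mul_le_mul_of_nonneg_left (ih _ _) (hπ K hK)
      _ = ∑ K ∈ 𝒦, ∑ a ∈ (Y \ K).filter (fun a => ω ∈ conn a),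
            π K * (∑ K ∈ 𝒦.filter (fun K => a ∉ K), π K) ^ i := by
          simp_rw [Finset.mul_sum]
      _ = ∑ a ∈ Y.filter (fun a => ω ∈ conn a), ∑ K ∈ 𝒦.filter (fun K => a ∉ K),
            π K * (∑ K ∈ 𝒦.filter (fun K => a ∉ K), π K) ^ i := by
          refine Finset.sum_comm' fun K a => ?_
          simp only [Finset.mem_filter, Finset.mem_sdiff]
          tauto
      _ = ∑ a ∈ Y.filter (fun a => ω ∈ conn a),
            (∑ K ∈ 𝒦.filter (fun K => a ∉ K), π K) ^ (i + 1) := by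
          refine Finset.sum_congr rfl fun a _ => ?_
          rw [← Finset.sum_mul, pow_succ']

/-- Lower bound on the `B`-expectation of the weight recursion:
`E[1_B · V_i(Y)] ≥ u^{i+1} - D(Y)` (`u = m B`, `D(Y) = m (⋃_{a ∈ Y} conn a)ᶜ`), by induction
on `i` from the averaging hypothesis `hH` and `∑_K π K = u`. [folklore] -/
theorem weightRec_lower_bound [Fintype Ω] (𝒦 : Finset (Finset ι)) (π : Finset ι → ℝ)
    (hπ : ∀ K ∈ 𝒦, 0 ≤ π K) (conn : ι → Set Ω) (V : ℕ → Finset ι → Ω → ℝ)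
    (hV0 : ∀ Y ω, V 0 Y ω = (⋃ a ∈ Y, conn a).indicator 1 ω)
    (hVs : ∀ i Y ω, V (i + 1) Y ω = ∑ K ∈ 𝒦, π K * V i (Y \ K) ω)
    (q : Ω → ℝ) (hq : ∀ ω, 0 ≤ q ω) (m : Set Ω → ℝ)
    (hm : ∀ E, m E = ∑ ω, q ω * E.indicator 1 ω) (B : Set Ω)
    (hu : ∑ K ∈ 𝒦, π K = m B)
    (hH : ∀ X : Finset ι,
      ∑ K ∈ 𝒦, π K * m (⋃ a ∈ X \ K, conn a)ᶜ ≤ m ((⋃ a ∈ X, conn a)ᶜ ∩ B)) :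
    ∀ (i : ℕ) (Y : Finset ι),
      m B ^ (i + 1) - m (⋃ a ∈ Y, conn a)ᶜ ≤
        ∑ ω, q ω * (B.indicator 1 ω * V i Y ω) := by
  intro i
  induction i with
  | zero =>
    intro Y
    rw [zero_add, pow_one, hm B, hm (⋃ a ∈ Y, conn a)ᶜ, ← Finset.sum_sub_distrib]
    refine Finset.sum_le_sum fun ω _ => ?_
    rw [← mul_sub, hV0]
    refine mul_le_mul_of_nonneg_left ?_ (hq ω)
    by_cases hB : ω ∈ B <;> by_cases hG : ω ∈ ⋃ a ∈ Y, conn a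
    · rw [Set.indicator_of_mem hB, Set.indicator_of_mem hG,
        Set.indicator_of_notMem (show ω ∉ (⋃ a ∈ Y, conn a)ᶜ from fun h => h hG)]
      norm_num
    · rw [Set.indicator_of_mem hB, Set.indicator_of_notMem hG,
        Set.indicator_of_mem (show ω ∈ (⋃ a ∈ Y, conn a)ᶜ from hG)]
      norm_num
    · rw [Set.indicator_of_notMem hB, Set.indicator_of_mem hG,
        Set.indicator_of_notMem (show ω ∉ (⋃ a ∈ Y, conn a)ᶜ from fun h => h hG)]
      norm_num
    · rw [Set.indicator_of_notMem hB, Set.indicator_of_notMem hG,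
        Set.indicator_of_mem (show ω ∈ (⋃ a ∈ Y, conn a)ᶜ from hG)]
      norm_num
  | succ i ih =>
    intro Y
    have hmono : m ((⋃ a ∈ Y, conn a)ᶜ ∩ B) ≤ m (⋃ a ∈ Y, conn a)ᶜ := by
      rw [hm, hm]
      refine Finset.sum_le_sum fun ω _ => mul_le_mul_of_nonneg_left ?_ (hq ω)
      exact Set.indicator_le_indicator_of_subset Set.inter_subset_left (fun _ => zero_le_one) ω
    calc m B ^ (i + 1 + 1) - m (⋃ a ∈ Y, conn a)ᶜ
        ≤ m B ^ (i + 1 + 1) - ∑ K ∈ 𝒦, π K * m (⋃ a ∈ Y \ K, conn a)ᶜ := by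
          linarith [hH Y]
      _ = ∑ K ∈ 𝒦, π K * (m B ^ (i + 1) - m (⋃ a ∈ Y \ K, conn a)ᶜ) := by
          simp only [mul_sub, Finset.sum_sub_distrib]
          rw [← Finset.sum_mul, hu]
          ring
      _ ≤ ∑ K ∈ 𝒦, π K * ∑ ω, q ω * (B.indicator 1 ω * V i (Y \ K) ω) :=
          Finset.sum_le_sum fun K hK => mul_le_mul_of_nonneg_left (ih (Y \ K)) (hπ K hK)
      _ = ∑ ω, q ω * (B.indicator 1 ω * V (i + 1) Y ω) := by
          simp_rw [hVs, Finset.mul_sum]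
          rw [Finset.sum_comm]
          refine Finset.sum_congr rfl fun ω _ => Finset.sum_congr rfl fun K _ => ?_
          ring

end Abstract

variable {n : ℕ}

/-- On the finite configuration space, `μ(E) = ∑_ω μ{ω} · 1_E(ω)`. [folklore] -/
theorem real_eq_sum_singleton (w : Sym2 (Fin n) → unitInterval) (E : Set (Set (Sym2 (Fin n)))) :
    (prodBernoulli w).real E = ∑ ω, (prodBernoulli w).real {ω} * E.indicator 1 ω := by
  calc (prodBernoulli w).real E = (prodBernoulli w).real (E.toFinset : Set _) := by
        rw [Set.coe_toFinset]
    _ = ∑ ω ∈ E.toFinset, (prodBernoulli w).real {ω} := (sum_measureReal_singleton _).symm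
    _ = ∑ ω, (prodBernoulli w).real {ω} * E.indicator 1 ω := by
        simp only [Set.indicator_apply, Pi.one_apply, mul_ite, mul_one, mul_zero]
        rw [← Finset.sum_filter]
        congr 1
        ext ω
        simp

/-- The events `{C(b) = K}`, `K ∌ o`, partition `{o ↮ b}`:
`∑_{K ∌ o} μ(C(b) = K) = μ(o ↮ b)`. [folklore] -/
theorem sum_real_clusterIs_eq (w : Sym2 (Fin n) → unitInterval) (o b : Fin n) :
    ∑ K ∈ (Finset.univ : Finset (Finset (Fin n))).filter (fun K => o ∉ K),
        (prodBernoulli w).real {ω | openCluster ω b = (K : Set (Fin n))} =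
      (prodBernoulli w).real (openConn o b)ᶜ := by
  have hd : Set.PairwiseDisjoint
      (↑((Finset.univ : Finset (Finset (Fin n))).filter (fun K => o ∉ K)) :
        Set (Finset (Fin n)))
      (fun K : Finset (Fin n) =>
        {ω : Set (Sym2 (Fin n)) | openCluster ω b = (K : Set (Fin n))}) := by
    intro K _ K' _ hKK'
    exact Literature.Probability.Percolation.pairwise_disjoint_clusterIs b hKK'
  have hmeas : ∀ K ∈ (Finset.univ : Finset (Finset (Fin n))).filter (fun K => o ∉ K),
      MeasurableSet {ω : Set (Sym2 (Fin n)) | openCluster ω b = (K : Set (Fin n))} :=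
    fun K _ => Literature.Probability.Percolation.measurableSet_clusterIs b K
  rw [← measureReal_biUnion_finset hd hmeas]
  congr 1
  ext ω
  simp only [Set.mem_iUnion, Finset.mem_filter, Finset.mem_univ, true_and, Set.mem_setOf_eq,
    Set.mem_compl_iff, exists_prop]
  constructor
  · rintro ⟨K, hoK, hK⟩ hω
    apply hoK
    have h1 : o ∈ openCluster ω b := SimpleGraph.Reachable.symm hω
    rw [hK] at h1
    exact_mod_cast h1
  · intro hω
    refine ⟨(openCluster ω b).toFinset, ?_, by simp⟩
    intro h
    rw [Set.mem_toFinset] at h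
    exact hω (SimpleGraph.Reachable.symm h)

/-- `∑_{K ∌ o, K ∌ a} μ(C(b) = K) ≤ μ(a ↮ b)` (disjoint events contained in `{a ∉ C(b)}`).
[folklore] -/
theorem sum_real_clusterIs_notMem_le (w : Sym2 (Fin n) → unitInterval) (o b a : Fin n) :
    ∑ K ∈ ((Finset.univ : Finset (Finset (Fin n))).filter (fun K => o ∉ K)).filter
        (fun K => a ∉ K), (prodBernoulli w).real {ω | openCluster ω b = (K : Set (Fin n))} ≤
      (prodBernoulli w).real (openConn a b)ᶜ := by
  have hd : Set.PairwiseDisjoint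
      (↑(((Finset.univ : Finset (Finset (Fin n))).filter (fun K => o ∉ K)).filter
        (fun K => a ∉ K)) : Set (Finset (Fin n)))
      (fun K : Finset (Fin n) =>
        {ω : Set (Sym2 (Fin n)) | openCluster ω b = (K : Set (Fin n))}) := by
    intro K _ K' _ hKK'
    exact Literature.Probability.Percolation.pairwise_disjoint_clusterIs b hKK'
  have hmeas : ∀ K ∈ ((Finset.univ : Finset (Finset (Fin n))).filter (fun K => o ∉ K)).filter
      (fun K => a ∉ K),
      MeasurableSet {ω : Set (Sym2 (Fin n)) | openCluster ω b = (K : Set (Fin n))} :=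
    fun K _ => Literature.Probability.Percolation.measurableSet_clusterIs b K
  rw [← measureReal_biUnion_finset hd hmeas]
  refine measureReal_mono ?_
  intro ω hω
  simp only [Set.mem_iUnion, Finset.mem_filter, Finset.mem_univ, true_and, Set.mem_setOf_eq,
    exists_prop] at hω
  obtain ⟨K, ⟨-, haK⟩, hK⟩ := hω
  intro hab
  apply haK
  have h1 : a ∈ openCluster ω b := SimpleGraph.Reachable.symm hab
  rw [hK] at h1
  exact_mod_cast h1

end MultiCopyFootprint

open MultiCopyFootprint in
/-- MULTI-COPY FOOTPRINT LEMMA (line independent-bad-world, stub 2): given fresh-pocket averaging for the instance, for every `j`, `0 < δ`, `θ ∈ (0,1)` with `μ(o↮A) ≤ δ`, `μ(a↮b) ≤ δ ∀a∈A`: `(1−θ)·u^j·μ{o↮b ∧ N·δ^j < θ·u^j} ≤ δ`, `u = μ(o↮b)`, `N = |{a ∈ A : o ↔ a}|`. [folklore] -/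
theorem multiCopyFootprint :
    ∀ (n : ℕ) (w : Sym2 (Fin n) → unitInterval) (A : Finset (Fin n)) (o b : Fin n), (∀ X : Finset (Fin n), ∑ K ∈ (Finset.univ : Finset (Finset (Fin n))).filter (fun K => o ∉ K), (Literature.Probability.LatticeModels.prodBernoulli w).real {ω | Literature.Probability.Percolation.openCluster ω b = (K : Set (Fin n))} * (Literature.Probability.LatticeModels.prodBernoulli w).real (⋃ a ∈ X \ K, Literature.Probability.Percolation.openConn o a)ᶜ ≤ (Literature.Probability.LatticeModels.prodBernoulli w).real ((⋃ a ∈ X, Literature.Probability.Percolation.openConn o a)ᶜ ∩ (Literature.Probability.Percolation.openConn o b)ᶜ)) → ∀ (j : ℕ) (δ θ : ℝ), 0 < δ → 0 < θ → θ < 1 → (Literature.Probability.LatticeModels.prodBernoulli w).real (⋃ a ∈ A, Literature.Probability.Percolation.openConn o a)ᶜ ≤ δ → (∀ a ∈ A, (Literature.Probability.LatticeModels.prodBernoulli w).real (Literature.Probability.Percolation.openConn a b)ᶜ ≤ δ) → (1 - θ) * ((Literature.Probability.LatticeModels.prodBernoulli w).real (Literature.Probability.Percolation.openConn o b)ᶜ)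 ^ j * (Literature.Probability.LatticeModels.prodBernoulli w).real {ω | ω ∉ Literature.Probability.Percolation.openConn o b ∧ ((A.filter fun a => ω ∈ Literature.Probability.Percolation.openConn o a).card : ℝ) * δ ^ j < θ * ((Literature.Probability.LatticeModels.prodBernoulli w).real (Literature.Probability.Percolation.openConn o b)ᶜ) ^ j} ≤ δ := by
  intro n w A o b H j δ θ _hδ _hθ _hθ1 hA hrel
  -- notation
  set μ := prodBernoulli w
  set 𝒦 : Finset (Finset (Fin n)) :=
    (Finset.univ : Finset (Finset (Fin n))).filter (fun K => o ∉ K)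
  set π : Finset (Fin n) → ℝ := fun K => μ.real {ω | openCluster ω b = (K : Set (Fin n))}
  set u : ℝ := μ.real (openConn o b)ᶜ
  set S : Set (Set (Sym2 (Fin n))) := {ω | ω ∉ openConn o b ∧
    ((A.filter fun a => ω ∈ openConn o a).card : ℝ) * δ ^ j < θ * u ^ j}
  -- the weight recursion `V`
  set V : ℕ → Finset (Fin n) → Set (Sym2 (Fin n)) → ℝ := fun i =>
    Nat.rec (motive := fun _ => Finset (Fin n) → Set (Sym2 (Fin n)) → ℝ)
      (fun Y ω => (⋃ a ∈ Y, (openConn o a : Set (Set (Sym2 (Fin n))))).indicator 1 ω)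
      (fun _ f Y ω => ∑ K ∈ 𝒦, π K * f (Y \ K) ω) i
  have hV0 : ∀ (Y : Finset (Fin n)) (ω : Set (Sym2 (Fin n))),
      V 0 Y ω = (⋃ a ∈ Y, (openConn o a : Set (Set (Sym2 (Fin n))))).indicator 1 ω :=
    fun _ _ => rfl
  have hVs : ∀ (i : ℕ) (Y : Finset (Fin n)) (ω : Set (Sym2 (Fin n))),
      V (i + 1) Y ω = ∑ K ∈ 𝒦, π K * V i (Y \ K) ω := fun _ _ _ => rfl
  have hπ0 : ∀ K ∈ 𝒦, 0 ≤ π K := fun K _ => measureReal_nonneg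
  have hsum : ∑ K ∈ 𝒦, π K = u := sum_real_clusterIs_eq w o b
  have hm : ∀ E : Set (Set (Sym2 (Fin n))), μ.real E = ∑ ω, μ.real {ω} * E.indicator 1 ω :=
    real_eq_sum_singleton w
  -- (i)+(ii): lower bound on the `B`-expectation of `V_j(A)`
  have hlow : u ^ (j + 1) - μ.real (⋃ a ∈ A, (openConn o a : Set (Set (Sym2 (Fin n)))))ᶜ ≤
      ∑ ω, μ.real {ω} * ((openConn o b)ᶜ.indicator 1 ω * V j A ω) :=
    weightRec_lower_bound 𝒦 π hπ0 (fun a => openConn o a) V hV0 hVs (fun ω => μ.real {ω})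
      (fun _ => measureReal_nonneg) μ.real hm (openConn o b)ᶜ hsum H j A
  -- (iii): pointwise upper bound `1_B V_j(A) ≤ u^j 1_B - (1 - θ) u^j 1_S`
  have hpt : ∀ ω : Set (Sym2 (Fin n)), (openConn o b)ᶜ.indicator 1 ω * V j A ω ≤
      u ^ j * (openConn o b)ᶜ.indicator (1 : Set (Sym2 (Fin n)) → ℝ) ω -
        (1 - θ) * u ^ j * S.indicator 1 ω := by
    intro ω
    by_cases hB : ω ∈ (openConn o b)ᶜ
    · by_cases hSω : ω ∈ S
      · have h1 : V j A ω ≤ ∑ a ∈ A.filter (fun a => ω ∈ openConn o a),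
            (∑ K ∈ 𝒦.filter (fun K => a ∉ K), π K) ^ j :=
          weightRec_le_footprint 𝒦 π hπ0 (fun a => openConn o a) V hV0 hVs j A ω
        have h2 : ∑ a ∈ A.filter (fun a => ω ∈ openConn o a),
            (∑ K ∈ 𝒦.filter (fun K => a ∉ K), π K) ^ j ≤
            ((A.filter fun a => ω ∈ openConn o a).card : ℝ) * δ ^ j := by
          calc ∑ a ∈ A.filter (fun a => ω ∈ openConn o a),
                (∑ K ∈ 𝒦.filter (fun K => a ∉ K), π K) ^ j
              ≤ ∑ a ∈ A.filter (fun a => ω ∈ openConn o a), δ ^ j := by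
                refine Finset.sum_le_sum fun a ha => ?_
                have haA : a ∈ A := (Finset.mem_filter.1 ha).1
                exact pow_le_pow_left₀
                  (Finset.sum_nonneg fun K hK => hπ0 K (Finset.mem_filter.1 hK).1)
                  ((sum_real_clusterIs_notMem_le w o b a).trans (hrel a haA)) j
            _ = ((A.filter fun a => ω ∈ openConn o a).card : ℝ) * δ ^ j := by
                rw [Finset.sum_const, nsmul_eq_mul]
        have h3 : ((A.filter fun a => ω ∈ openConn o a).card : ℝ) * δ ^ j < θ * u ^ j :=
          hSω.2
        rw [Set.indicator_of_mem hB, Set.indicator_of_mem hSω, Pi.one_apply]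
        linarith
      · have h1 : V j A ω ≤ u ^ j :=
          weightRec_le_pow 𝒦 π hπ0 (fun a => openConn o a) V hV0 hVs u hsum j A ω
        rw [Set.indicator_of_mem hB, Set.indicator_of_notMem hSω, Pi.one_apply]
        linarith
    · have hSω : ω ∉ S := fun h => hB h.1
      rw [Set.indicator_of_notMem hB, Set.indicator_of_notMem hSω]
      simp
  -- (iv): sum the pointwise bound and conclude
  have hup : ∑ ω, μ.real {ω} * ((openConn o b)ᶜ.indicator 1 ω * V j A ω) ≤
      u ^ j * u - (1 - θ) * u ^ j * μ.real S := by
    calc ∑ ω, μ.real {ω} * ((openConn o b)ᶜ.indicator 1 ω * V j A ω)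
        ≤ ∑ ω, μ.real {ω} *
            (u ^ j * (openConn o b)ᶜ.indicator (1 : Set (Sym2 (Fin n)) → ℝ) ω -
              (1 - θ) * u ^ j * S.indicator 1 ω) :=
          Finset.sum_le_sum fun ω _ => mul_le_mul_of_nonneg_left (hpt ω) measureReal_nonneg
      _ = u ^ j * ∑ ω, μ.real {ω} * (openConn o b)ᶜ.indicator (1 : Set (Sym2 (Fin n)) → ℝ) ω
            - (1 - θ) * u ^ j * ∑ ω, μ.real {ω} * S.indicator 1 ω := by
          simp only [mul_sub, Finset.sum_sub_distrib, Finset.mul_sum]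
          congr 1
          · exact Finset.sum_congr rfl fun ω _ => by ring
          · exact Finset.sum_congr rfl fun ω _ => by ring
      _ = u ^ j * u - (1 - θ) * u ^ j * μ.real S := by rw [← hm, ← hm]
  have hfinal : (1 - θ) * u ^ j * μ.real S ≤
      μ.real (⋃ a ∈ A, (openConn o a : Set (Set (Sym2 (Fin n)))))ᶜ := by
    have := hlow.trans hup
    rw [pow_succ] at this
    linarith
  exact hfinal.trans hA

end Summit.CriticalPhenomena.PercolationContinuityZ3.Theorems
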